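import Summits.ValiantsHypothesis.ValiantsHypothesis.Theses.ValuativeGCT
import Literature.NumberTheory.DiophantineGeometry.SchurWeylPlethysmKroneckerBoundProofs
import Literature.NumberTheory.DiophantineGeometry.SchurWeylPlethysmOrbitWeightsProofs
import Literature.NumberTheory.DiophantineGeometry.GLHighestWeightFormRepProofs
import Literature.NumberTheory.DiophantineGeometry.KroneckerOneRow
import Literature.Computability.AlgebraicComplexity.OrbitCoordinateRingProofs

/-!
# `ValuativeGCT.ValuativeBound` (crux stmt-ValiantsHypothesis-12625) — negative side, 1/5: the ENGINE

Standing disprover (cdisprove), 2026-08-15.  `one_le_orbitMultiplicity_det_indiscrete m δ :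
1 ≤ K_m((mδ)*)` — the one-row dual weight `(0,…,0,-mδ) = (dualOfPartition (m*m) (mδ)).toMatIdx`
OCCURS in `ℂ[Δ(det_m)]` for every `m ≥ 1`, `δ ≥ 0`.  Witness: the class of `X_{x_last^m}^δ`, a
`B`-eigenvector of `coordRep` (under an upper triangular substitution only the last variable feeds
the last variable) lying outside `I(GL·det_m)` (value `1` at the End-orbit point
`det_m(x_{ab} ↦ [a=b]·x_last) = x_last^m`; the ideal is the kernel of the generic orbit map).
This lower bound on the LHS of the crux is what turns every collapsed-`T` variant into a FALSE
statement (files 2–5; the crux itself is TRUE — candidate proofs on the item).  Supports the item,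
does not close it.  Elementary; no new facts.
-/

noncomputable section

open MvPolynomial

namespace Summit.ValiantsHypothesis.Theorems.ValuativeBoundNegative

open Literature.NumberTheory.DiophantineGeometry Literature.Computability.AlgebraicComplexity

section Engine

variable (m : ℕ) [NeZero m]

/-- The lex-greatest matrix index `(m-1, m-1)` of `MatIdx m = Fin m ×ₗ Fin m`. [folklore] -/
def iLast : MatIdx m :=
  toLex (⟨m - 1, Nat.sub_one_lt (NeZero.ne m)⟩, ⟨m - 1, Nat.sub_one_lt (NeZero.ne m)⟩)

/-- Every matrix index is `≤ iLast m`. [folklore] -/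
theorem le_iLast (i : MatIdx m) : i ≤ iLast m := by
  rw [← toLex_ofLex i, iLast, Prod.Lex.toLex_le_toLex]
  have h1 := (ofLex i).1.isLt
  have h2 := (ofLex i).2.isLt
  rcases lt_or_ge ((ofLex i).1 : ℕ) (m - 1) with h | h
  · exact Or.inl (Fin.lt_def.mpr (by simpa using h))
  · right
    exact ⟨Fin.ext (by simp; omega), Fin.le_def.mpr (by simp; omega)⟩

/-- No index is strictly above `iLast m`. [folklore] -/
theorem not_iLast_lt (i : MatIdx m) : ¬ iLast m < i :=
  not_lt.mpr (le_iLast m i)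

/-- The degree-`m` monomial index of `x_{iLast}^m`. [folklore] -/
def dLast : DegIdx (MatIdx m) m :=
  ⟨Finsupp.single (iLast m) m, by rw [mem_degMonomials_iff, Finsupp.degree_single]⟩

/-- Unfolding lemma for `dLast`. [folklore] -/
@[simp] theorem dLast_val : (dLast m : MatIdx m →₀ ℕ) = Finsupp.single (iLast m) m := rfl

variable {m}

/-- For an upper triangular matrix `B`, the coefficient of `x_{iLast}^m` in `B · x^e` is
`B_{iLast,iLast}^m` if `e = x_{iLast}^m` and `0` otherwise (only the last variable feeds the last
variable). [folklore] -/
theorem coeff_single_iLast_linSubst_monomial {k : Type*} [Field k] {B : Matrix (MatIdx m) (MatIdx m) k}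
    (hB : B.BlockTriangular id) (e : MatIdx m →₀ ℕ) :
    coeff (Finsupp.single (iLast m) m) (linSubst (MatIdx m) k B (monomial e 1)) =
      if e = Finsupp.single (iLast m) m then B (iLast m) (iLast m) ^ m else 0 := by
  classical
  -- β = indicator of the last index; diagonal β ∘ B = diagonal β'
  set β : MatIdx m → k := fun i => if i = iLast m then 1 else 0 with hβ
  set β' : MatIdx m → k := fun i => if i = iLast m then B (iLast m) (iLast m) else 0 with hβ'
  have hmul : Matrix.diagonal β * B = Matrix.diagonal β' := by
    ext j i
    rw [Matrix.diagonal_mul, Matrix.diagonal_apply]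
    by_cases hj : j = iLast m
    · subst hj
      by_cases hi : iLast m = i
      · subst hi; simp [hβ, hβ']
      · rw [if_neg hi]
        have hlt : i < iLast m := lt_of_le_of_ne (le_iLast m i) (Ne.symm hi)
        simp only [hβ, if_true, one_mul]
        exact hB hlt
    · have : β j = 0 := by simp [hβ, hj]
      rw [this, zero_mul]
      by_cases hji : j = i
      · subst hji; simp [hβ', hj]
      · rw [if_neg hji]
  have key : ∀ q : MvPolynomial (MatIdx m) k, coeff (Finsupp.single (iLast m) m) q =
      coeff (Finsupp.single (iLast m) m) (linSubst (MatIdx m) k (Matrix.diagonal β) q) := by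
    intro q
    rw [coeff_linSubst_diagonal]
    have : (∏ i, β i ^ (Finsupp.single (iLast m) m) i) = 1 := by
      refine Finset.prod_eq_one fun i _ => ?_
      by_cases hi : i = iLast m
      · subst hi; simp [hβ]
      · rw [Finsupp.single_apply, if_neg (Ne.symm hi), pow_zero]
    rw [this, one_mul]
  rw [key, ← AlgHom.comp_apply, ← linSubst_mul, hmul, coeff_linSubst_diagonal, coeff_monomial]
  have hprod : (∏ i, β' i ^ (Finsupp.single (iLast m) m) i) = B (iLast m) (iLast m) ^ m := by
    rw [Finset.prod_eq_single (iLast m)]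
    · simp [hβ']
    · intro i _ hi
      rw [Finsupp.single_apply, if_neg (Ne.symm hi), pow_zero]
    · intro h; exact absurd (Finset.mem_univ _) h
  rw [hprod]
  split_ifs with h <;> simp

/-- **The Borel acts on the coordinate `X_{x_last^m}` by the character `b ↦ b_{last,last}^{-m}`.** [folklore] -/
theorem coordSubst_X_dLast {k : Type*} [Field k] {g : GL (MatIdx m) k} (hg : IsUpperTriangular g) :
    coordSubst m g (X (dLast m) : MvPolynomial (DegIdx (MatIdx m) m) k) =
      (((g : Matrix (MatIdx m) (MatIdx m) k) (iLast m) (iLast m))⁻¹ ^ m) • X (dLast m) := by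
  classical
  have hg' : IsUpperTriangular g⁻¹ := (borelSubgroup (MatIdx m) k).inv_mem hg
  rw [coordSubst_X, Finset.sum_eq_single (dLast m)]
  · rw [linSubstRep_apply, dLast_val, coeff_single_iLast_linSubst_monomial hg', if_pos rfl,
      inv_apply_diag_of_isUpperTriangular' hg]
  · intro e _ hne
    rw [linSubstRep_apply, dLast_val, coeff_single_iLast_linSubst_monomial hg', if_neg, zero_smul]
    intro h
    exact hne (Subtype.ext h)
  · intro h; exact absurd (Finset.mem_univ _) h

variable (m)

/-- The weight `(0, …, 0, -n)` on `MatIdx m` (entry `-n` at the lex-last index). [folklore] -/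
def lastWeight (n : ℕ) : Weight (MatIdx m) :=
  fun i => if i = iLast m then -(n : ℤ) else 0

/-- The character of `lastWeight m n` is `g ↦ (g_{last,last})^{-n}`. [folklore] -/
theorem weightChar_lastWeight {k : Type*} [Field k] (n : ℕ) (g : GL (MatIdx m) k) :
    weightChar (lastWeight m n) g = (((g : Matrix (MatIdx m) (MatIdx m) k) (iLast m) (iLast m))⁻¹) ^ n := by
  classical
  rw [weightChar, Finset.prod_eq_single (iLast m)]
  · simp [lastWeight, zpow_neg, zpow_natCast, inv_pow]
  · intro i _ hi
    simp [lastWeight, hi]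
  · intro h; exact absurd (Finset.mem_univ _) h

/-- **`X_{x_last^m}^δ` is a `B`-semi-invariant of weight `(0,…,0,-mδ)` in `k[Sym^m]`.** [folklore] -/
theorem coordSubst_X_dLast_pow {k : Type*} [Field k] {g : GL (MatIdx m) k} (hg : IsUpperTriangular g)
    (δ : ℕ) :
    coordSubst m g ((X (dLast m) : MvPolynomial (DegIdx (MatIdx m) m) k) ^ δ) =
      weightChar (lastWeight m (m * δ)) g • (X (dLast m)) ^ δ := by
  rw [map_pow, coordSubst_X_dLast hg, smul_pow, weightChar_lastWeight, ← pow_mul]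

/-- The class of `X_{x_last^m}^δ` in `k[Δ(f)]` is a highest-weight vector of weight
`(0,…,0,-mδ)`, for every form `f`. [folklore] -/
theorem mk_X_dLast_pow_mem_highestWeightSpace {k : Type*} [Field k] (f : MvPolynomial (MatIdx m) k)
    (δ : ℕ) :
    Ideal.Quotient.mk (orbitVanishingIdeal f m) ((X (dLast m) : MvPolynomial (DegIdx (MatIdx m) m) k) ^ δ) ∈
      highestWeightSpace (orbitCoordRep f m) (lastWeight m (m * δ)) := by
  intro g hg
  rw [orbitCoordRep_apply, orbitCoordSubst_mk, coordSubst_X_dLast_pow m hg]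
  exact map_smul (Ideal.Quotient.mkₐ k (orbitVanishingIdeal f m)) _ _

/-- The singular substitution `x_{ab} ↦ [a = b] · x_{last}` (all diagonal variables to the last
variable, off-diagonal variables to `0`), as a matrix for `linSubst`. [folklore] -/
def diagToLast (k : Type*) [Field k] : Matrix (MatIdx m) (MatIdx m) k :=
  fun j i => if j = iLast m ∧ (ofLex i).1 = (ofLex i).2 then 1 else 0

/-- `diagToLast` sends the variable `x_{ab}` to `[a = b]·x_last`. [folklore] -/
theorem linSubst_diagToLast_X {k : Type*} [Field k] (a b : Fin m) :
    linSubst (MatIdx m) k (diagToLast m k) (X (toLex (a, b))) = if a = b then X (iLast m) else 0 := by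
  classical
  rw [linSubst_X, Finset.sum_eq_single (iLast m)]
  · simp only [diagToLast, ofLex_toLex, true_and]
    split_ifs <;> simp
  · intro j _ hj
    simp [diagToLast, hj]
  · intro h; exact absurd (Finset.mem_univ _) h

/-- **`det_m` under `x_{ab} ↦ [a=b] x_last` is `x_last^m`.** [folklore] -/
theorem linSubst_diagToLast_detFormLex {k : Type*} [Field k] :
    linSubst (MatIdx m) k (diagToLast m k) (detFormLex k m) = X (iLast m) ^ m := by
  classical
  rw [detFormLex, detPoly, AlgHom.map_det, AlgHom.map_det]
  have : ((linSubst (MatIdx m) k (diagToLast m k)).mapMatrix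
      ((rename toLex : MvPolynomial (Fin m × Fin m) k →ₐ[k] _).mapMatrix
        (Matrix.mvPolynomialX (Fin m) (Fin m) k))) = Matrix.diagonal fun _ => X (iLast m) := by
    ext a b
    simp only [AlgHom.mapMatrix_apply, Matrix.map_apply, Matrix.mvPolynomialX_apply, rename_X,
      linSubst_diagToLast_X, Matrix.diagonal_apply]
  rw [this, Matrix.det_diagonal, Finset.prod_const, Finset.card_univ, Fintype.card_fin]

/-- **`X_{x_last^m}^δ ∉ I(GL · det_m)`**: it takes the value `1` at the End-orbit point
`x_last^m = det_m(diagToLast · x)`, while `I(GL·det_m)` is the kernel of the generic orbit map. [folklore] -/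
theorem X_dLast_pow_not_mem_orbitVanishingIdeal (δ : ℕ) :
    ((X (dLast m) : MvPolynomial (DegIdx (MatIdx m) m) ℂ) ^ δ) ∉ orbitVanishingIdeal (detFormLex ℂ m) m := by
  classical
  intro hmem
  have hker : genericOrbitMap (detFormLex ℂ m) m ((X (dLast m)) ^ δ) = 0 := by
    rw [orbitVanishingIdeal_eq_ker_genericOrbitMap, RingHom.mem_ker] at hmem
    exact hmem
  have h := eval_genericOrbitMap (detFormLex ℂ m) m ((X (dLast m)) ^ δ) (diagToLast m ℂ)
  rw [hker, map_zero, linSubst_diagToLast_detFormLex, map_pow, aeval_X, formCoeff_apply, dLast_val] at h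
  have hc : coeff (Finsupp.single (iLast m) m) ((X (iLast m) : MvPolynomial (MatIdx m) ℂ) ^ m) = 1 := by
    rw [X_pow_eq_monomial, coeff_monomial, if_pos rfl]
  rw [hc, one_pow] at h
  exact zero_ne_one h

/-- FiniteDimensionality of the highest-weight spaces of `ℂ[Δ(det_m)]` (tree fact, discharged). [folklore] -/
instance finiteDimensional_hw (χ : Weight (MatIdx m)) :
    FiniteDimensional ℂ (highestWeightSpace (orbitCoordRep (detFormLex ℂ m) m) χ) :=
  finiteDimensional_highestWeightSpace_orbitCoordRep_holds (detFormLex ℂ m) (NeZero.ne m) χ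

/-- **ENGINE. `1 ≤ K_m((0,…,0,-mδ))`**: the weight `(mδ)*` occurs in `ℂ[Δ(det_m)]` for every
`m ≥ 1` and every `δ` (witness: the class of `X_{x_last^m}^δ`). [folklore] -/
theorem one_le_orbitMultiplicity_det_lastWeight (δ : ℕ) :
    1 ≤ orbitMultiplicity ℂ (detFormLex ℂ m) m (lastWeight m (m * δ)) := by
  rw [orbitMultiplicity, hwMultiplicity, Nat.one_le_iff_ne_zero, ← Nat.pos_iff_ne_zero,
    Module.finrank_pos_iff_exists_ne_zero]
  refine ⟨⟨_, mk_X_dLast_pow_mem_highestWeightSpace m (detFormLex ℂ m) δ⟩, ?_⟩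
  intro h
  have h' := congrArg Subtype.val h
  simp only [Submodule.coe_zero] at h'
  exact X_dLast_pow_not_mem_orbitVanishingIdeal m δ (Ideal.Quotient.eq_zero_iff_mem.mp h')

/-- The lexicographic enumeration sends the last index of `Fin (m*m)` to `iLast m`
(order isomorphisms preserve greatest elements). [folklore] -/
theorem val_matIdxEquiv_symm_iLast : (((matIdxEquiv m).symm (iLast m) : Fin (m * m)) : ℕ) = m * m - 1 := by
  have hmm : 0 < m * m := Nat.mul_pos (NeZero.pos m) (NeZero.pos m)
  set a₀ : Fin (m * m) := ⟨m * m - 1, Nat.sub_one_lt hmm.ne'⟩ with ha₀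
  have h1 : (matIdxEquiv m).symm (iLast m) ≤ a₀ :=
    Fin.le_def.mpr (by have := ((matIdxEquiv m).symm (iLast m)).isLt; simp [ha₀]; omega)
  have h2 : a₀ ≤ (matIdxEquiv m).symm (iLast m) := by
    have := (matIdxEquiv m).symm.monotone (le_iLast m (matIdxEquiv m a₀))
    rwa [OrderIso.symm_apply_apply] at this
  rw [le_antisymm h1 h2]

/-- Partitions of `0` have no parts. [folklore] -/
theorem sortedParts_eq_nil_of_eq_zero {n : ℕ} (hn : n = 0) (μ : Nat.Partition n) : μ.sortedParts = [] := by
  subst hn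
  simp [Nat.Partition.sortedParts, Nat.Partition.partition_zero_parts]

/-- The crux's weight `(dualOfPartition (m*m) (mδ)).toMatIdx` of the one-row partition `(mδ)` IS
`lastWeight m (mδ)`. [folklore] -/
theorem toMatIdx_dualOfPartition_indiscrete (δ : ℕ) :
    (Weight.dualOfPartition (m * m) (Nat.Partition.indiscrete (m * δ))).toMatIdx = lastWeight m (m * δ) := by
  funext i
  simp only [Weight.toMatIdx, lastWeight, Weight.dualOfPartition, Weight.dual, Weight.ofPartition_apply]
  by_cases hδ : m * δ = 0
  · rw [sortedParts_eq_nil_of_eq_zero hδ, hδ]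
    simp
  · rw [sortedParts_indiscrete hδ]
    have hrev : ∀ j : Fin (m * m), ((Fin.rev j : Fin (m * m)) : ℕ) = 0 ↔ (j : ℕ) = m * m - 1 := by
      intro j
      have := j.isLt
      simp [Fin.rev]
      omega
    by_cases hi : i = iLast m
    · subst hi
      have h0 : ((Fin.rev ((matIdxEquiv m).symm (iLast m)) : Fin (m * m)) : ℕ) = 0 :=
        (hrev _).mpr (val_matIdxEquiv_symm_iLast m)
      rw [if_pos rfl, h0]
      simp
    · rw [if_neg hi]
      have hne : ((Fin.rev ((matIdxEquiv m).symm i) : Fin (m * m)) : ℕ) ≠ 0 := by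
        intro h0
        apply hi
        have hv := (hrev _).mp h0
        have : (matIdxEquiv m).symm i = (matIdxEquiv m).symm (iLast m) :=
          Fin.ext (by rw [hv, val_matIdxEquiv_symm_iLast])
        exact (matIdxEquiv m).symm.injective this
      obtain ⟨n, hn⟩ := Nat.exists_eq_succ_of_ne_zero hne
      rw [hn]
      simp

/-- **ENGINE, crux weight form. `1 ≤ K_m((mδ)*)`** with the weight written exactly as in the crux. [folklore] -/
theorem one_le_orbitMultiplicity_det_indiscrete (δ : ℕ) :
    1 ≤ orbitMultiplicity ℂ (detFormLex ℂ m) m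
      (Weight.dualOfPartition (m * m) (Nat.Partition.indiscrete (m * δ))).toMatIdx := by
  rw [toMatIdx_dualOfPartition_indiscrete]
  exact one_le_orbitMultiplicity_det_lastWeight m δ

/-- The one-row partition has at most `1 ≤ m*m` parts (the crux's guard is met). [folklore] -/
theorem card_parts_indiscrete_le (n : ℕ) : (Nat.Partition.indiscrete n).parts.card ≤ m * m := by
  have hmm : 1 ≤ m * m := Nat.mul_pos (NeZero.pos m) (NeZero.pos m)
  by_cases hn : n = 0
  · subst hn; simp [Nat.Partition.partition_zero_parts]
  · rw [Nat.Partition.indiscrete_parts hn]; simpa using hmm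

end Engine

end Summit.ValiantsHypothesis.Theorems.ValuativeBoundNegative

end
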